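import Literature.Analysis.Fourier.FermionicPoissonSummation
import Mathlib.Analysis.Fourier.FourierTransformDeriv
import HarnessLib

/-!
# Fermionic Matsubara sums vs. the `β = ∞` kernel: the `O(β^{-2})` image tail from TWO frequency derivatives

Topic `Analysis/Fourier`; companion of `FermionicPoissonSummation.lean` (`(1/β) Σ_n e^{-iω_nτ} G(ω_n) = Σ_m (-1)^m ǧ(τ + mβ)`,
`ǧ(t) = (1/2π)·𝓕G(t/2π)`, and the tail `A·π/(6β²)` beyond the two nearest images GIVEN `‖𝓕G(t/2π)‖ ≤ A/t²`).  Here the quadratic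
decay is DISCHARGED from two integrable derivatives of `G` (integration by parts twice, Mathlib `Real.fourier_iteratedDeriv`:
`𝓕(G'')(ξ) = (2πiξ)² 𝓕G(ξ)`), so every hypothesis is on the frequency function `G` alone:

* `norm_fourier_le_integral_iteratedDeriv_two` — `‖𝓕G(ξ)‖ ≤ ‖G''‖_{L¹}/(2π|ξ|)²` (`ξ ≠ 0`) for `G ∈ C²` with `G, G', G''` integrable
  [cite: SteinWeiss1971, Ch. I Thm. 1.8]; in the Matsubara normalisation `‖𝓕G(t/2π)‖ ≤ ‖G''‖_{L¹}/t²`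
  (`norm_fourier_div_two_pi_le`) — the `V₂ = ∫|∂²_ω G̃|` currency of a UV propagator's time decay;
* **`norm_fermionicMatsubaraSum_sub_nearestImages_le_of_iteratedDeriv`** — for `G ∈ C²(ℝ)`, `G = O(|ω|^{-b})` (`b > 1`),
  `G, G', G''` integrable, `β > 0`, `τ ∈ [0, β]`:
  `‖(1/β) Σ_n e^{-iω_nτ} G(ω_n) - (1/2π)(𝓕G(τ/2π) - 𝓕G((τ-β)/2π))‖ ≤ ‖G''‖_{L¹}·π/(6β²)`;
* `norm_fermionicMatsubaraSum_sub_kernel_le_of_iteratedDeriv` — dropping also the antiperiodic partner `ǧ(τ - β)`: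
  `‖(1/β) Σ_n e^{-iω_nτ} G(ω_n) - (1/2π)𝓕G(τ/2π)‖ ≤ ‖G''‖_{L¹}·((1/2π)/(β-τ)² + π/(6β²))` for `τ ∈ [0, β)` — the finite-`β` kernel
  converges to the `β = ∞` one at rate `β^{-2}` away from the antiperiodic edge `τ = β`.

Everything is proved; no definitions, no named facts. [cite: FetterWalecka1971, Ch. 7 §25]

## References

* E. M. Stein, G. Weiss, *Introduction to Fourier Analysis on Euclidean Spaces* (1971), Ch. I Thm. 1.8 and (1.9)(ii) (transform of a derivative; Thm. 1.7 is the dual direction),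
  Ch. VII Cor. 2.6 (Poisson summation). [SteinWeiss1971]
* A. L. Fetter, J. D. Walecka, *Quantum Theory of Many-Particle Systems* (1971), Ch. 7 §25. [FetterWalecka1971]
-/

noncomputable section

open MeasureTheory Complex Filter Asymptotics Topology
open scoped FourierTransform Real

namespace Literature.Analysis.Fourier

/-! ### §1 Quadratic Fourier decay from two integrable derivatives -/

/-- **`‖𝓕G(ξ)‖ ≤ ‖G''‖_{L¹}/(2π|ξ|)²`** for `ξ ≠ 0`, when `G ∈ C²(ℝ)` and `G, G', G''` are integrable (integration by parts twice:
`𝓕(G'')(ξ) = (2πiξ)²·𝓕G(ξ)`, Mathlib `Real.fourier_iteratedDeriv`). [cite: SteinWeiss1971, Ch. I Thm. 1.8] -/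
theorem norm_fourier_le_integral_iteratedDeriv_two {G : ℝ → ℂ} (hG : ContDiff ℝ 2 G)
    (hint : ∀ n : ℕ, n ≤ 2 → Integrable (iteratedDeriv n G)) {ξ : ℝ} (hξ : ξ ≠ 0) :
    ‖𝓕 G ξ‖ ≤ (∫ x : ℝ, ‖iteratedDeriv 2 G x‖) / (2 * π * |ξ|) ^ 2 := by
  have key := congrFun (Real.fourier_iteratedDeriv (N := ((2 : ℕ) : ℕ∞)) (n := 2) hG
    (fun n hn => hint n (by exact_mod_cast hn)) le_rfl) ξ
  have hnorm : ‖𝓕 (iteratedDeriv 2 G) ξ‖ ≤ ∫ x : ℝ, ‖iteratedDeriv 2 G x‖ :=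
    VectorFourier.norm_fourierIntegral_le_integral_norm _ _ _ _ _
  rw [key, norm_smul, norm_pow] at hnorm
  have hc : ‖2 * (π : ℂ) * I * ξ‖ = 2 * π * |ξ| := by
    rw [norm_mul, norm_mul, norm_mul, Complex.norm_I, mul_one, Complex.norm_real, Real.norm_eq_abs, Complex.norm_real,
      Real.norm_eq_abs, abs_of_pos Real.pi_pos, Complex.norm_ofNat]
  rw [hc] at hnorm
  have hpos : 0 < (2 * π * |ξ|) ^ 2 := by
    have : 0 < |ξ| := abs_pos.2 hξ
    positivity
  rw [le_div_iff₀ hpos, mul_comm]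
  exact hnorm

/-- The same in the Matsubara normalisation: `‖𝓕G(t/2π)‖ ≤ ‖G''‖_{L¹}/t²` for `t ≠ 0` (so `|ǧ(t)| = (1/2π)‖𝓕G(t/2π)‖ ≤ ‖G''‖_{L¹}/(2πt²)`).
[cite: SteinWeiss1971, Ch. I Thm. 1.8] -/
theorem norm_fourier_div_two_pi_le {G : ℝ → ℂ} (hG : ContDiff ℝ 2 G)
    (hint : ∀ n : ℕ, n ≤ 2 → Integrable (iteratedDeriv n G)) {t : ℝ} (ht : t ≠ 0) :
    ‖𝓕 G (t / (2 * π))‖ ≤ (∫ x : ℝ, ‖iteratedDeriv 2 G x‖) / t ^ 2 := by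
  have hπ : 0 < π := Real.pi_pos
  have h := norm_fourier_le_integral_iteratedDeriv_two hG hint (ξ := t / (2 * π)) (by positivity)
  have heq : (2 * π * |t / (2 * π)|) ^ 2 = t ^ 2 := by
    rw [abs_div, abs_of_pos (by positivity : (0 : ℝ) < 2 * π), mul_div_cancel₀ _ (by positivity : (2 : ℝ) * π ≠ 0), sq_abs]
  rwa [heq] at h

/-! ### §2 The image tail and the `β → ∞` rate, hypotheses on `G` alone -/

/-- **The two nearest images carry the fermionic Matsubara sum up to `‖G''‖_{L¹}·π/(6β²)`**: for `G ∈ C²(ℝ)` with `G, G', G''`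
integrable and `G = O(|ω|^{-b})` (`b > 1`), `β > 0`, `τ ∈ [0, β]`:
`‖(1/β) Σ_n e^{-iω_nτ} G(ω_n) - (1/2π)(𝓕G(τ/2π) - 𝓕G((τ-β)/2π))‖ ≤ ‖G''‖_{L¹}·π/(6β²)` (`ω_n = (2n+1)π/β`).
[cite: FetterWalecka1971, Ch. 7 §25] -/
theorem norm_fermionicMatsubaraSum_sub_nearestImages_le_of_iteratedDeriv {G : ℝ → ℂ} (hG : ContDiff ℝ 2 G)
    (hint : ∀ n : ℕ, n ≤ 2 → Integrable (iteratedDeriv n G)) {b : ℝ} (hb : 1 < b)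
    (hGO : G =O[cocompact ℝ] fun x : ℝ => |x| ^ (-b)) {β : ℝ} (hβ : 0 < β) {τ : ℝ} (hτ0 : 0 ≤ τ) (hτβ : τ ≤ β) :
    ‖((1 / β : ℝ) : ℂ) * ∑' n : ℤ, cexp (-(I * (((2 * n + 1) * π / β : ℝ) : ℂ) * τ)) * G ((2 * n + 1) * π / β) -
        ((1 / (2 * π) : ℝ) : ℂ) * (𝓕 G (τ / (2 * π)) - 𝓕 G ((τ - β) / (2 * π)))‖ ≤
      (∫ x : ℝ, ‖iteratedDeriv 2 G x‖) * π / (6 * β ^ 2) :=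
  norm_fermionicMatsubaraSum_sub_nearestImages_le hG.continuous hb hGO hβ hτ0 hτβ
    (fun _ ht => norm_fourier_div_two_pi_le hG hint ht)

/-- **Rate of convergence to the `β = ∞` kernel away from the antiperiodic edge**: under the same hypotheses, for `τ ∈ [0, β)`,
`‖(1/β) Σ_n e^{-iω_nτ} G(ω_n) - (1/2π)𝓕G(τ/2π)‖ ≤ ‖G''‖_{L¹}·((1/2π)/(β - τ)² + π/(6β²))` — the antiperiodic partner `ǧ(τ - β)` is
`≤ ‖G''‖_{L¹}/(2π(β-τ)²)` by `norm_fourier_div_two_pi_le`. [cite: FetterWalecka1971, Ch. 7 §25] -/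
theorem norm_fermionicMatsubaraSum_sub_kernel_le_of_iteratedDeriv {G : ℝ → ℂ} (hG : ContDiff ℝ 2 G)
    (hint : ∀ n : ℕ, n ≤ 2 → Integrable (iteratedDeriv n G)) {b : ℝ} (hb : 1 < b)
    (hGO : G =O[cocompact ℝ] fun x : ℝ => |x| ^ (-b)) {β : ℝ} (hβ : 0 < β) {τ : ℝ} (hτ0 : 0 ≤ τ) (hτβ : τ < β) :
    ‖((1 / β : ℝ) : ℂ) * ∑' n : ℤ, cexp (-(I * (((2 * n + 1) * π / β : ℝ) : ℂ) * τ)) * G ((2 * n + 1) * π / β) -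
        ((1 / (2 * π) : ℝ) : ℂ) * 𝓕 G (τ / (2 * π))‖ ≤
      (∫ x : ℝ, ‖iteratedDeriv 2 G x‖) * ((1 / (2 * π)) / (β - τ) ^ 2 + π / (6 * β ^ 2)) := by
  set S := ((1 / β : ℝ) : ℂ) * ∑' n : ℤ, cexp (-(I * (((2 * n + 1) * π / β : ℝ) : ℂ) * τ)) * G ((2 * n + 1) * π / β) with hS
  set V := ∫ x : ℝ, ‖iteratedDeriv 2 G x‖ with hV
  have hπ : 0 < π := Real.pi_pos
  have hV0 : 0 ≤ V := integral_nonneg fun x => norm_nonneg _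
  have h1 := norm_fermionicMatsubaraSum_sub_nearestImages_le_of_iteratedDeriv hG hint hb hGO hβ hτ0 hτβ.le
  have h2 : ‖((1 / (2 * π) : ℝ) : ℂ) * 𝓕 G ((τ - β) / (2 * π))‖ ≤ 1 / (2 * π) * (V / (β - τ) ^ 2) := by
    rw [norm_mul, Complex.norm_real, Real.norm_of_nonneg (by positivity)]
    refine mul_le_mul_of_nonneg_left ?_ (by positivity)
    have h := norm_fourier_div_two_pi_le hG hint (t := τ - β) (by linarith)
    rwa [show (τ - β) ^ 2 = (β - τ) ^ 2 by ring] at h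
  have hdecomp : S - ((1 / (2 * π) : ℝ) : ℂ) * 𝓕 G (τ / (2 * π)) =
      (S - ((1 / (2 * π) : ℝ) : ℂ) * (𝓕 G (τ / (2 * π)) - 𝓕 G ((τ - β) / (2 * π)))) -
        ((1 / (2 * π) : ℝ) : ℂ) * 𝓕 G ((τ - β) / (2 * π)) := by ring
  rw [hdecomp]
  calc ‖(S - ((1 / (2 * π) : ℝ) : ℂ) * (𝓕 G (τ / (2 * π)) - 𝓕 G ((τ - β) / (2 * π)))) -
          ((1 / (2 * π) : ℝ) : ℂ) * 𝓕 G ((τ - β) / (2 * π))‖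
        ≤ ‖S - ((1 / (2 * π) : ℝ) : ℂ) * (𝓕 G (τ / (2 * π)) - 𝓕 G ((τ - β) / (2 * π)))‖ +
          ‖((1 / (2 * π) : ℝ) : ℂ) * 𝓕 G ((τ - β) / (2 * π))‖ := norm_sub_le _ _
    _ ≤ V * π / (6 * β ^ 2) + 1 / (2 * π) * (V / (β - τ) ^ 2) := add_le_add h1 h2
    _ = V * ((1 / (2 * π)) / (β - τ) ^ 2 + π / (6 * β ^ 2)) := by ring

end Literature.Analysis.Fourier

end
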